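import Literature.Computability.Cryptography.WordRAMBounds
import HarnessLib

/-!
# The word RAM — programs as word lists (a Gödel numbering for universal simulation)

A concrete coding of word-RAM programs (`Literature.Computability.Cryptography.WordRAM`) as lists
of words, eight words per instruction, `[opc, dκ, dv, xκ, xv, yκ, yv, t]`:

* `BinOp.code` (`add ↦ 1, …, eq ↦ 12`), `Operand.kind` (`imm ↦ 0, dir ↦ 1, ind ↦ 2`) with the
  operand's constant `Operand.const` (`Literature.Computability.Cryptography.WordRAMBounds`) as
  value; opcodes `halt ↦ 0`, `op o ↦ o.code`, `jmp ↦ 13`, `jz ↦ 14`, `rand ↦ 15`, `query ↦ 16`;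
* total decoders `BinOp.decode`, `Operand.decode`, `Instr.decode`, `Program.decode n ws` (the
  program with `n` instructions whose fields are read off `ws` with default `0`); every word list
  decodes to *some* deterministic oracle-free program (unknown opcodes, in particular those of
  `rand` and `query`, decode to `halt`; operand kinds `≥ 2` decode to `ind`), which is what a
  universal program interpreting arbitrary data needs;
* `Program.decode_code`: decoding inverts coding on deterministic oracle-free programs, with any
  trailing words ignored;
* bounds: the constants and jump targets of a decoded program are bounded by the words it was
  decoded from (`Program.maxConst_decode_le`, `Program.target_le_of_mem_decode`).

This is the standard "programs as data" device of universal machines (Cook–Reckhow,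
*Time bounded random access machines*, JCSS 7 (1973), §2: RAM programs stored in registers and
interpreted), here for the instruction set of `WordRAM.Instr`.

## References

* S. A. Cook, R. A. Reckhow, *Time bounded random access machines*, J. Comput. Syst. Sci. 7
  (1973), 354–375, §2.
-/

namespace Literature.Computability.Cryptography.WordRAM

/-! ## Operations -/

/-- The opcode of a binary operation (`1, …, 12`). [folklore] -/
def BinOp.code : BinOp → ℕ
  | .add => 1 | .sub => 2 | .mul => 3 | .div => 4 | .mod => 5 | .band => 6
  | .bor => 7 | .bxor => 8 | .shl => 9 | .shr => 10 | .lt => 11 | .eq => 12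

/-- The (total) decoder of binary operations; words other than `1, …, 11` decode to `eq`. [folklore] -/
def BinOp.decode (n : ℕ) : BinOp :=
  if n = 1 then .add else if n = 2 then .sub else if n = 3 then .mul else if n = 4 then .div
  else if n = 5 then .mod else if n = 6 then .band else if n = 7 then .bor else if n = 8 then .bxor
  else if n = 9 then .shl else if n = 10 then .shr else if n = 11 then .lt else .eq

/-- Decoding inverts coding on operations. [folklore] -/
@[simp] theorem BinOp.decode_code (o : BinOp) : BinOp.decode o.code = o := by
  cases o <;> rfl

/-- Opcodes of operations lie in `[1, 12]`. [folklore] -/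
theorem BinOp.one_le_code (o : BinOp) : 1 ≤ o.code := by cases o <;> simp [BinOp.code]

/-- Opcodes of operations lie in `[1, 12]`. [folklore] -/
theorem BinOp.code_le (o : BinOp) : o.code ≤ 12 := by cases o <;> simp [BinOp.code]

/-! ## Operands -/

/-- The addressing-mode word of an operand: `imm ↦ 0`, `dir ↦ 1`, `ind ↦ 2`. [folklore] -/
def Operand.kind : Operand → ℕ
  | .imm _ => 0
  | .dir _ => 1
  | .ind _ => 2

/-- The (total) decoder of operands from (mode, value); modes `≥ 2` decode to `ind`. [folklore] -/
def Operand.decode (κ v : ℕ) : Operand :=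
  if κ = 0 then .imm v else if κ = 1 then .dir v else .ind v

/-- Decoding inverts coding on operands. [folklore] -/
@[simp] theorem Operand.decode_kind_const (o : Operand) : Operand.decode o.kind o.const = o := by
  cases o <;> rfl

/-- The constant of a decoded operand is the value word. [folklore] -/
@[simp] theorem Operand.const_decode (κ v : ℕ) : (Operand.decode κ v).const = v := by
  unfold Operand.decode; split_ifs <;> rfl

/-- Reading a decoded operand: immediate, direct or indirect according to the mode word. [folklore] -/
theorem Operand.read_decode (κ v : ℕ) (mem : ℕ → ℕ) :
    (Operand.decode κ v).read mem = if κ = 0 then v else if κ = 1 then mem v else mem (mem v) := by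
  unfold Operand.decode; split_ifs <;> rfl

/-- Writing through a decoded operand. [folklore] -/
theorem Operand.write_decode (κ v : ℕ) (mem : ℕ → ℕ) (val : ℕ) :
    (Operand.decode κ v).write mem val =
      if κ = 0 then mem else if κ = 1 then Function.update mem v val
      else Function.update mem (mem v) val := by
  unfold Operand.decode; split_ifs <;> rfl

/-! ## Instructions -/

/-- The code of an instruction: eight words `[opc, dκ, dv, xκ, xv, yκ, yv, t]`. [folklore] -/
def Instr.code : Instr → List ℕ
  | .op o d x y => [o.code, d.kind, d.const, x.kind, x.const, y.kind, y.const, 0]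
  | .jmp t => [13, 0, 0, 0, 0, 0, 0, t]
  | .jz x t => [14, 0, 0, x.kind, x.const, 0, 0, t]
  | .rand d => [15, d.kind, d.const, 0, 0, 0, 0, 0]
  | .query qa ql aa => [16, qa.kind, qa.const, ql.kind, ql.const, aa.kind, aa.const, 0]
  | .halt => [0, 0, 0, 0, 0, 0, 0, 0]

/-- Every instruction code has eight words. [folklore] -/
@[simp] theorem Instr.code_length (I : Instr) : I.code.length = 8 := by
  cases I <;> rfl

/-- The (total) decoder of instructions from the eight fields; opcode `0` and unknown opcodes
(`≥ 15`, in particular those of `rand` and `query`) decode to `halt`. [folklore] -/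
def Instr.decode (opc dκ dv xκ xv yκ yv t : ℕ) : Instr :=
  if opc = 0 then .halt
  else if opc ≤ 12 then .op (BinOp.decode opc) (Operand.decode dκ dv) (Operand.decode xκ xv)
    (Operand.decode yκ yv)
  else if opc = 13 then .jmp t
  else if opc = 14 then .jz (Operand.decode xκ xv) t
  else .halt

/-- Decode an instruction from a list of (at least) eight fields, missing fields read as `0`. [folklore] -/
def Instr.decodeList (l : List ℕ) : Instr :=
  Instr.decode (l.getD 0 0) (l.getD 1 0) (l.getD 2 0) (l.getD 3 0) (l.getD 4 0) (l.getD 5 0)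
    (l.getD 6 0) (l.getD 7 0)

/-- Decoding inverts coding on instructions other than `rand` and `query`. [folklore] -/
theorem Instr.decodeList_code (I : Instr) (hr : I.isRand = false) (hq : I.isQuery = false) :
    Instr.decodeList I.code = I := by
  cases I with
  | op o d x y =>
    have h1 := BinOp.one_le_code o
    have h2 := BinOp.code_le o
    simp only [Instr.code, Instr.decodeList, List.getD_cons_zero, List.getD_cons_succ, Instr.decode,
      BinOp.decode_code, Operand.decode_kind_const]
    rw [if_neg (by omega), if_pos h2]
  | jmp t => rfl
  | jz x t => simp [Instr.code, Instr.decodeList, Instr.decode]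
  | rand d => simp [Instr.isRand] at hr
  | query qa ql aa => simp [Instr.isQuery] at hq
  | halt => rfl

/-- A decoded instruction is never `rand`. [folklore] -/
theorem Instr.decode_isRand (opc dκ dv xκ xv yκ yv t : ℕ) :
    (Instr.decode opc dκ dv xκ xv yκ yv t).isRand = false := by
  unfold Instr.decode; split_ifs <;> rfl

/-- A decoded instruction is never `query`. [folklore] -/
theorem Instr.decode_isQuery (opc dκ dv xκ xv yκ yv t : ℕ) :
    (Instr.decode opc dκ dv xκ xv yκ yv t).isQuery = false := by
  unfold Instr.decode; split_ifs <;> rfl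

/-- The constants of a decoded instruction are among its value fields. [folklore] -/
theorem Instr.maxConst_decode_le {opc dκ dv xκ xv yκ yv t V : ℕ} (hd : dv ≤ V) (hx : xv ≤ V)
    (hy : yv ≤ V) : (Instr.decode opc dκ dv xκ xv yκ yv t).maxConst ≤ V := by
  unfold Instr.decode
  split_ifs <;> simp [Instr.maxConst, *]

/-- The jump target of an instruction (`0` for non-jumps). [folklore] -/
def Instr.target : Instr → ℕ
  | .jmp t => t
  | .jz _ t => t
  | _ => 0

/-- The jump target of a decoded instruction is at most its target field. [folklore] -/
theorem Instr.target_decode_le (opc dκ dv xκ xv yκ yv t : ℕ) :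
    (Instr.decode opc dκ dv xκ xv yκ yv t).target ≤ t := by
  unfold Instr.decode
  split_ifs <;> simp [Instr.target]

/-! ## Programs -/

/-- The code of a program: the concatenation of the codes of its instructions. [folklore] -/
def Program.code (P : Program) : List ℕ :=
  (P.map Instr.code).flatten

/-- The code of a program with `n` instructions has `8 n` words. [folklore] -/
@[simp] theorem Program.code_length (P : Program) : (Program.code P).length = 8 * P.length := by
  induction P with
  | nil => rfl
  | cons I P ih =>
    simp only [Program.code, List.map_cons, List.flatten_cons, List.length_append,
      Instr.code_length, List.length_cons] at ih ⊢
    rw [ih]; omega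

/-- Unfolding the code of a nonempty program. [folklore] -/
theorem Program.code_cons (I : Instr) (P : Program) :
    Program.code (I :: P) = I.code ++ Program.code P := rfl

/-- The fields of the code: word `8 i + f` of `code P ++ rest` is field `f` of instruction `i`. [folklore] -/
theorem Program.getD_code_append (P : Program) (rest : List ℕ) {i f : ℕ} (hi : i < P.length)
    (hf : f < 8) : (Program.code P ++ rest).getD (8 * i + f) 0 = (P[i].code).getD f 0 := by
  induction P generalizing i with
  | nil => simp at hi
  | cons I P ih =>
    cases i with
    | zero =>
      rw [Program.code_cons, List.append_assoc, Nat.mul_zero, Nat.zero_add, List.getD_eq_getElem?_getD,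
        List.getElem?_append_left (by simp; omega), List.getElem_cons_zero, List.getD_eq_getElem?_getD]
    | succ i =>
      have hi' : i < P.length := by simpa using hi
      rw [Program.code_cons, List.append_assoc, List.getD_eq_getElem?_getD,
        show 8 * (i + 1) + f = I.code.length + (8 * i + f) by simp; omega,
        List.getElem?_append_right (by omega), Nat.add_sub_cancel_left, ← List.getD_eq_getElem?_getD,
        ih hi', List.getElem_cons_succ]

/-- The program with `n` instructions decoded from the word list `ws` (fields of instruction `i`
at positions `8 i, …, 8 i + 7`, missing words read as `0`). [folklore] -/
def Program.decode (n : ℕ) (ws : List ℕ) : Program :=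
  (List.range n).map fun i => Instr.decode (ws.getD (8 * i) 0) (ws.getD (8 * i + 1) 0)
    (ws.getD (8 * i + 2) 0) (ws.getD (8 * i + 3) 0) (ws.getD (8 * i + 4) 0) (ws.getD (8 * i + 5) 0)
    (ws.getD (8 * i + 6) 0) (ws.getD (8 * i + 7) 0)

/-- A decoded program has the announced number of instructions. [folklore] -/
@[simp] theorem Program.decode_length (n : ℕ) (ws : List ℕ) : (Program.decode n ws).length = n := by
  simp [Program.decode]

/-- The instructions of a decoded program. [folklore] -/
theorem Program.getElem?_decode {n : ℕ} (ws : List ℕ) {i : ℕ} (hi : i < n) :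
    (Program.decode n ws)[i]? = some (Instr.decode (ws.getD (8 * i) 0) (ws.getD (8 * i + 1) 0)
      (ws.getD (8 * i + 2) 0) (ws.getD (8 * i + 3) 0) (ws.getD (8 * i + 4) 0) (ws.getD (8 * i + 5) 0)
      (ws.getD (8 * i + 6) 0) (ws.getD (8 * i + 7) 0)) := by
  simp [Program.decode, List.getElem?_range hi]

/-- A decoded program is deterministic. [folklore] -/
theorem Program.decode_isDeterministic (n : ℕ) (ws : List ℕ) : (Program.decode n ws).IsDeterministic := by
  intro I hI
  simp only [Program.decode, List.mem_map, List.mem_range] at hI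
  obtain ⟨i, -, rfl⟩ := hI
  exact Instr.decode_isRand ..

/-- A decoded program is oracle-free. [folklore] -/
theorem Program.decode_isOracleFree (n : ℕ) (ws : List ℕ) : (Program.decode n ws).IsOracleFree := by
  intro I hI
  simp only [Program.decode, List.mem_map, List.mem_range] at hI
  obtain ⟨i, -, rfl⟩ := hI
  exact Instr.decode_isQuery ..

/-- **Decoding inverts coding** on deterministic oracle-free programs; trailing words are ignored.
[folklore] -/
theorem Program.decode_code {P : Program} (hd : P.IsDeterministic) (ho : P.IsOracleFree)
    (rest : List ℕ) : Program.decode P.length (Program.code P ++ rest) = P := by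
  apply List.ext_getElem?
  intro i
  by_cases hi : i < P.length
  · rw [Program.getElem?_decode _ hi, List.getElem?_eq_getElem hi, Option.some.injEq]
    have e : ∀ f, f < 8 → (Program.code P ++ rest).getD (8 * i + f) 0 = (P[i].code).getD f 0 :=
      fun f hf => Program.getD_code_append P rest hi hf
    have e0 := e 0 (by omega)
    rw [Nat.add_zero] at e0
    rw [e0, e 1 (by omega), e 2 (by omega), e 3 (by omega), e 4 (by omega),
      e 5 (by omega), e 6 (by omega), e 7 (by omega)]
    exact Instr.decodeList_code _ (hd _ (List.getElem_mem hi)) (ho _ (List.getElem_mem hi))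
  · rw [List.getElem?_eq_none (by simp; omega), List.getElem?_eq_none (by omega)]

/-- The constants of a decoded program are bounded by the words it was decoded from. [folklore] -/
theorem Program.maxConst_decode_le {n V : ℕ} {ws : List ℕ} (h : ∀ j, j < 8 * n → ws.getD j 0 ≤ V) :
    Program.maxConst (Program.decode n ws) ≤ V := by
  unfold Program.maxConst
  suffices hs : ∀ I ∈ Program.decode n ws, I.maxConst ≤ V by
    generalize hl : Program.decode n ws = l at hs
    clear hl
    induction l with
    | nil => simp
    | cons I l ih =>
      rw [List.map_cons, List.foldr_cons]
      exact max_le (hs I (by simp)) (ih fun J hJ => hs J (by simp [hJ]))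
  intro I hI
  simp only [Program.decode, List.mem_map, List.mem_range] at hI
  obtain ⟨i, hi, rfl⟩ := hI
  exact Instr.maxConst_decode_le (h _ (by omega)) (h _ (by omega)) (h _ (by omega))

/-- The jump targets of a decoded program are bounded by the words it was decoded from. [folklore] -/
theorem Program.target_le_of_mem_decode {n V : ℕ} {ws : List ℕ} (h : ∀ j, j < 8 * n → ws.getD j 0 ≤ V)
    {I : Instr} (hI : I ∈ Program.decode n ws) : I.target ≤ V := by
  simp only [Program.decode, List.mem_map, List.mem_range] at hI
  obtain ⟨i, hi, rfl⟩ := hI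
  exact le_trans (Instr.target_decode_le ..) (h _ (by omega))

/-- The words of the code of a program are bounded by `16`, its constants and its jump targets. [folklore] -/
theorem Program.forall_mem_code_le (P : Program) {V : ℕ} (h16 : 16 ≤ V)
    (hc : Program.maxConst P ≤ V) (ht : ∀ I ∈ P, I.target ≤ V) : ∀ v ∈ Program.code P, v ≤ V := by
  intro v hv
  simp only [Program.code, List.mem_flatten, List.mem_map] at hv
  obtain ⟨l, ⟨I, hI, rfl⟩, hv⟩ := hv
  have hIc : I.maxConst ≤ V := le_trans (Instr.maxConst_le_of_mem hI) hc
  have hIt := ht I hI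
  have hk : ∀ o : Operand, o.kind ≤ V := fun o => by cases o <;> simp [Operand.kind] <;> omega
  have ho : ∀ o : BinOp, o.code ≤ V := fun o => le_trans (BinOp.code_le o) (by omega)
  cases I with
  | op o d x y =>
    simp only [Instr.maxConst, max_le_iff] at hIc
    simp only [Instr.code, List.mem_cons, List.not_mem_nil, or_false] at hv
    rcases hv with rfl | rfl | rfl | rfl | rfl | rfl | rfl | rfl
    · exact ho o
    · exact hk d
    · exact hIc.1
    · exact hk x
    · exact hIc.2.1
    · exact hk y
    · exact hIc.2.2
    · omega
  | jmp t =>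
    simp only [Instr.target] at hIt
    simp only [Instr.code, List.mem_cons, List.not_mem_nil, or_false] at hv
    rcases hv with rfl | rfl | rfl | rfl | rfl | rfl | rfl | rfl <;> omega
  | jz x t =>
    simp only [Instr.maxConst] at hIc
    simp only [Instr.target] at hIt
    simp only [Instr.code, List.mem_cons, List.not_mem_nil, or_false] at hv
    rcases hv with rfl | rfl | rfl | rfl | rfl | rfl | rfl | rfl
    · omega
    · omega
    · omega
    · exact hk x
    · exact hIc
    · omega
    · omega
    · exact hIt
  | rand d =>
    simp only [Instr.maxConst] at hIc
    simp only [Instr.code, List.mem_cons, List.not_mem_nil, or_false] at hv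
    rcases hv with rfl | rfl | rfl | rfl | rfl | rfl | rfl | rfl
    · omega
    · exact hk d
    · exact hIc
    all_goals omega
  | query qa ql aa =>
    simp only [Instr.maxConst, max_le_iff] at hIc
    simp only [Instr.code, List.mem_cons, List.not_mem_nil, or_false] at hv
    rcases hv with rfl | rfl | rfl | rfl | rfl | rfl | rfl | rfl
    · omega
    · exact hk qa
    · exact hIc.1
    · exact hk ql
    · exact hIc.2.1
    · exact hk aa
    · exact hIc.2.2
    · omega
  | halt =>
    simp only [Instr.code, List.mem_cons, List.not_mem_nil, or_false] at hv
    rcases hv with rfl | rfl | rfl | rfl | rfl | rfl | rfl | rfl <;> omega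

end Literature.Computability.Cryptography.WordRAM
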